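import Summits.QuantumFields.YangMills.Theorems.IR.SiteRPDoubling

/-!
# Site-hyperplane reflection positivity, file 3∕4: transfer to `ℤ^d` (free-boundary partition functions) and box bookkeeping

Landed for item `stmt-QuantumFields-19354` (`--supports … --as helper`) by the LEAD prover ab-p1 under director-ym RULING g9-№2 ∕ №14 (3)
(critic ym-ir-crit-2 03:04:13Z ∕ 03:14:37Z: PASS as supplier); authored by ideator ym-ir-idea-5 g7, split of the sorry-free workfile
`Cruxes/IR/Lines/pressure_monotone_tm.lean` v5 (Part B = `Cruxes/IR/Lines/rp_doubling.lean`) per `Cruxes/IR/Lines/pressure_monotone_tm_LANDING.md`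
(eight files: `SiteRPGeometry` → `SiteRPDoubling` → `SiteRPZdBoxes` → `SiteRPFreeCubeDoubling`; `PressureMonotoneTMFloor` → `…LinearFloor` → `…LogFloor` → `…Equipartition`).

Content (§4 and §5a of Part B): `zReflect`, `ZTouches`∕`zPlaqReflect`∕`ZIsUpper`∕`ZIsFace`∕`zDouble`, `toT`, `zdZ` (= the tree's free-boundary `zdPartitionFunction` as a real),
★ `zdZ_sq_le_zdZ_zDouble`; `bump`, `boxPlaqs`, `mem_cubePlaqs_iff`, `cubePlaqs_eq_boxPlaqs`, `boxPlaqs_image_shift`, ★ `zDouble_boxPlaqs`.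

HONESTY.  Supplier ∕ kinematic content only (holds for `U(1)` too): nothing here proves the Yang–Mills mass gap (Clay), `BalabanLadder.IR`,
`BalabanLadder.NT` or a lattice gap; R4 closes only the conditional finite-𝕋⁴ rung `BalabanLadder.UV`.
-/

open MeasureTheory Finset Filter
open scoped ComplexConjugate

namespace Summit.QuantumFields.YangMills.Cruxes.IR.RPDoubling

open Literature.MathematicalPhysics.QuantumFieldTheory
open Literature.MathematicalPhysics.QuantumLattice

noncomputable section

/-! ## §4 Transfer to `ℤ^d`: the doubling inequality for free-boundary partition functions -/

section Zd

open scoped Classical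
open Literature.Probability.LatticeModels (halfOpenBox Torus.proj)

variable {d : ℕ}

/-- Reflection of `ℤ^d` in the lattice hyperplane `x_i = c₀`. -/
def zReflect (i : Fin d) (c₀ : ℤ) (x : Fin d → ℤ) : Fin d → ℤ := Function.update x i (c₀ + c₀ - x i)

/-- The plaquette lies in a plane containing `eᵢ`. -/
def ZTouches (i : Fin d) (p : ZdPlaquette d) : Prop := p.2.1.1 = i ∨ p.2.1.2 = i

/-- Reflection of plaquettes of `ℤ^d` in the hyperplane `x_i = c₀`. -/
def zPlaqReflect (i : Fin d) (c₀ : ℤ) (p : ZdPlaquette d) : ZdPlaquette d :=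
  (if ZTouches i p then zReflect i c₀ p.1 - Pi.single i 1 else zReflect i c₀ p.1, p.2)

/-- Upper plaquettes of range `H` above the hyperplane `x_i = c₀`. -/
def ZIsUpper (i : Fin d) (c₀ : ℤ) (H : ℕ) (p : ZdPlaquette d) : Prop :=
  (¬ ZTouches i p ∧ c₀ ≤ p.1 i ∧ p.1 i ≤ c₀ + H) ∨ (ZTouches i p ∧ c₀ ≤ p.1 i ∧ p.1 i + 1 ≤ c₀ + H)

/-- Face plaquettes: those inside the hyperplane `x_i = c₀`. -/
def ZIsFace (i : Fin d) (c₀ : ℤ) (p : ZdPlaquette d) : Prop := ¬ ZTouches i p ∧ p.1 i = c₀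

/-- The DOUBLED set `A ∪ θ(A ∖ faces)`. -/
def zDouble (i : Fin d) (c₀ : ℤ) (I : Finset (ZdPlaquette d)) : Finset (ZdPlaquette d) :=
  I ∪ (I.filter fun p => ¬ ZIsFace i c₀ p).image (zPlaqReflect i c₀)

/-- The torus plaquette below a plaquette of `ℤ^d`. -/
def toT (L : ℕ) (p : ZdPlaquette d) : Plaquette d L := (Torus.proj L p.1, p.2)

/-- Projection `ℤ^d → (ℤ/L)^d` intertwines `zReflect i c₀` with `siteReflect i c₀`. -/
theorem proj_zReflect (L : ℕ) (i : Fin d) (c₀ : ℤ) (x : Fin d → ℤ) :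
    Torus.proj L (zReflect i c₀ x) = siteReflect i (c₀ : ZMod L) (Torus.proj L x) := by
  ext k
  by_cases hk : k = i
  · subst hk; simp [Torus.proj, zReflect]
  · simp [Torus.proj, zReflect, hk]

/-- Projection `ℤ^d → (ℤ/L)^d` commutes with subtracting `e_i`. -/
theorem proj_sub_single (L : ℕ) (i : Fin d) (x : Fin d → ℤ) :
    Torus.proj L (x - Pi.single i 1) = Torus.proj L x - Pi.single i 1 := by
  ext k
  by_cases hk : k = i
  · subst hk; simp [Torus.proj]
  · simp [Torus.proj, hk]

/-- `toT L` intertwines the `ℤ^d` plaquette reflection with the torus one. -/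
theorem toT_zPlaqReflect (L : ℕ) (i : Fin d) (c₀ : ℤ) (p : ZdPlaquette d) :
    toT L (zPlaqReflect i c₀ p) = plaqReflect i (c₀ : ZMod L) (toT L p) := by
  unfold toT zPlaqReflect plaqReflect ZTouches
  by_cases h : p.2.1.1 = i ∨ p.2.1.2 = i
  · rw [if_pos h, if_pos h, proj_sub_single, proj_zReflect]
  · rw [if_neg h, if_neg h, proj_zReflect]

/-- For `c₀ ≤ x i < c₀ + L` the torus height of the projected site is `x i − c₀`. -/
theorem ht_toT (L : ℕ) [NeZero L] (i : Fin d) (c₀ : ℤ) (x : Fin d → ℤ) (h0 : c₀ ≤ x i) (hL : x i < c₀ + L) :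
    ((ht i (c₀ : ZMod L) (Torus.proj L x) : ℕ) : ℤ) = x i - c₀ := by
  unfold ht
  have : (Torus.proj L x) i - (c₀ : ZMod L) = ((x i - c₀ : ℤ) : ZMod L) := by simp [Torus.proj]
  rw [this, ZMod.val_intCast]
  exact Int.emod_eq_of_lt (by omega) (by omega)

/-- An upper `ℤ^d` plaquette (w.r.t. `c₀`, height `≤ H < L`) projects to an upper torus plaquette. -/
theorem isUpper_toT {L : ℕ} [NeZero L] {i : Fin d} {c₀ : ℤ} {H : ℕ} (hHL : H < L) {p : ZdPlaquette d}
    (hp : ZIsUpper i c₀ H p) : IsUpper i (c₀ : ZMod L) H (toT L p) := by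
  have hT : Touches i (toT L p) ↔ ZTouches i p := Iff.rfl
  unfold IsUpper
  rw [hT]
  unfold ZIsUpper at hp
  have hx : c₀ ≤ p.1 i ∧ p.1 i < c₀ + L := by rcases hp with h | h <;> constructor <;> omega
  have hh := ht_toT L i c₀ p.1 hx.1 hx.2
  change ((ht i (c₀ : ZMod L) (toT L p).1 : ℕ) : ℤ) = p.1 i - c₀ at hh
  rcases hp with h | h
  · left; exact ⟨h.1, by omega⟩
  · right; exact ⟨h.1, by omega⟩

/-- For upper plaquettes, being a face is preserved and reflected by the projection `toT L`. -/
theorem isFace_toT_iff {L : ℕ} [NeZero L] {i : Fin d} {c₀ : ℤ} {H : ℕ} (hHL : H < L) {p : ZdPlaquette d}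
    (hp : ZIsUpper i c₀ H p) : IsFace i (c₀ : ZMod L) (toT L p) ↔ ZIsFace i c₀ p := by
  have hT : Touches i (toT L p) ↔ ZTouches i p := Iff.rfl
  unfold IsFace ZIsFace
  rw [hT]
  unfold ZIsUpper at hp
  have hx : c₀ ≤ p.1 i ∧ p.1 i < c₀ + L := by rcases hp with h | h <;> constructor <;> omega
  have hh := ht_toT L i c₀ p.1 hx.1 hx.2
  change ((ht i (c₀ : ZMod L) (toT L p).1 : ℕ) : ℤ) = p.1 i - c₀ at hh
  constructor
  · rintro ⟨h1, h2⟩; exact ⟨h1, by omega⟩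
  · rintro ⟨h1, h2⟩; exact ⟨h1, by omega⟩

variable {N : ℕ} {G : Type*} [Group G] [TopologicalSpace G] [IsTopologicalGroup G] [CompactSpace G]
  [MeasurableSpace G] [BorelSpace G] [SecondCountableTopology G]
variable (ρ : G →* Matrix (Fin N) (Fin N) ℂ) (β : ℝ)

/-- The free-boundary partition function `Z(A) = ∫ ∏_{p ∈ A} exp(-β (N - Re tr ρ(U_p))) dg_∞` of a finite
set of plaquettes of `ℤ^d` (the tree's `ℨ⟦β, A⟧`). -/
def zdZ (A : Finset (ZdPlaquette d)) : ℝ :=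
  ∫ U, ∏ p ∈ A, Real.exp (-β * ((N : ℝ) - plaquetteObs ρ p.1 p.2.1.1 p.2.1.2 U)) ∂zdHaar d G

omit [SecondCountableTopology G] in
/-- `0 ≤ zdZ ρ β A` (the free-boundary partition function as a real). -/
theorem zdZ_nonneg (A : Finset (ZdPlaquette d)) : 0 ≤ zdZ ρ β A :=
  integral_nonneg fun _ => prod_nonneg fun _ _ => (Real.exp_pos _).le

/-- **The doubling inequality on `ℤ^d`**: for a finite set `I` of upper plaquettes of range `H` above the
hyperplane `x_i = c₀` (placed inside `[0, L-2]^d` together with its double, `2H < L`),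
`Z(I)² ≤ Z(I ∪ θ(I ∖ faces))`. -/
theorem zdZ_sq_le_zdZ_zDouble (hρ : Continuous ρ) (hρN : ∀ g, (ρ g).trace.re ≤ N) (hβ : 0 ≤ β)
    (i : Fin d) (c₀ : ℤ) {H L : ℕ} [NeZero L] (hH : 2 * H < L) {I : Finset (ZdPlaquette d)}
    (hup : ∀ p ∈ I, ZIsUpper i c₀ H p) (hI : ∀ p ∈ I, ∀ k, 0 ≤ p.1 k ∧ p.1 k + 2 ≤ L)
    (hD : ∀ p ∈ zDouble i c₀ I, ∀ k, 0 ≤ p.1 k ∧ p.1 k + 2 ≤ L) :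
    zdZ ρ β I ^ 2 ≤ zdZ ρ β (zDouble i c₀ I) := by
  have hHL : H < L := by omega
  have hA : ∀ q ∈ I.image (toT L), IsUpper i (c₀ : ZMod L) H q := by
    intro q hq
    obtain ⟨p, hp, rfl⟩ := mem_image.1 hq
    exact isUpper_toT hHL (hup p hp)
  have key := sq_integral_prod_tw_le ρ β hρ hρN hβ hH hA
  have hset : I.image (toT L) ∪ ((I.image (toT L)).filter fun q => ¬ IsFace i (c₀ : ZMod L) q).image
      (plaqReflect i (c₀ : ZMod L)) = (zDouble i c₀ I).image (toT L) := by
    rw [zDouble, image_union, Finset.filter_image, image_image, image_image]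
    congr 1
    have hf : (I.filter fun p => ¬ IsFace i (c₀ : ZMod L) (toT L p)) = I.filter fun p => ¬ ZIsFace i c₀ p :=
      filter_congr fun p hp => by rw [isFace_toT_iff hHL (hup p hp)]
    rw [hf]
    exact image_congr fun p _ => by simp [Function.comp, toT_zPlaqReflect]
  rw [hset] at key
  have e1 : (∫ U, ∏ p ∈ I.image (toT L), tw ρ β p U ∂(Measure.pi fun _ : Edge d L => haarProbability G)) =
      zdZ ρ β I := FreeEnergy.integral_torusWeight_image ρ hρ β hI
  have e2 : (∫ U, ∏ p ∈ (zDouble i c₀ I).image (toT L), tw ρ β p U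
      ∂(Measure.pi fun _ : Edge d L => haarProbability G)) = zdZ ρ β (zDouble i c₀ I) :=
    FreeEnergy.integral_torusWeight_image ρ hρ β hD
  rw [e1, e2] at key
  exact key

end Zd

/-! ## §5 Boxes: `d` successive reflections double a cube, `Z(B_m)^(2^d) ≤ Z(B_{2m-1})` -/

section Boxes

open scoped Classical
open Literature.Probability.LatticeModels (halfOpenBox Torus.proj)

variable {d : ℕ}

/-- `1` if the plaquette extends in direction `k`, else `0`. -/
def bump (p : ZdPlaquette d) (k : Fin d) : ℤ := if ZTouches k p then 1 else 0

/-- `0 ≤ bump p k`. -/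
theorem bump_nonneg (p : ZdPlaquette d) (k : Fin d) : 0 ≤ bump p k := by
  unfold bump; split_ifs <;> norm_num

/-- `bump p k ≤ 1`. -/
theorem bump_le_one (p : ZdPlaquette d) (k : Fin d) : bump p k ≤ 1 := by
  unfold bump; split_ifs <;> norm_num

/-- `bump p k = 1` when the plaquette touches direction `k`. -/
theorem bump_of_touches {p : ZdPlaquette d} {k : Fin d} (h : ZTouches k p) : bump p k = 1 := if_pos h

/-- `bump p k = 0` when the plaquette does not touch direction `k`. -/
theorem bump_of_not_touches {p : ZdPlaquette d} {k : Fin d} (h : ¬ ZTouches k p) : bump p k = 0 := if_neg h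

/-- `bump p k` as the sum of the two direction indicators of the plaquette. -/
theorem bump_eq (p : ZdPlaquette d) (k : Fin d) :
    bump p k = (if k = p.2.1.1 then 1 else 0) + (if k = p.2.1.2 then 1 else 0) := by
  have hne : p.2.1.1 ≠ p.2.1.2 := ne_of_lt p.2.2
  unfold bump ZTouches
  by_cases h1 : k = p.2.1.1 <;> by_cases h2 : k = p.2.1.2
  · exact absurd (h1.symm.trans h2) hne
  · rw [if_pos (Or.inl h1.symm), if_pos h1, if_neg h2]; norm_num
  · rw [if_pos (Or.inr h2.symm), if_neg h1, if_pos h2]; norm_num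
  · rw [if_neg (by rintro (h | h) <;> [exact h1 h.symm; exact h2 h.symm]), if_neg h1, if_neg h2]; norm_num

/-- `(zPlaqReflect p).2 = p.2`, so bumps are unchanged. -/
theorem bump_zPlaqReflect (i : Fin d) (c₀ : ℤ) (p : ZdPlaquette d) (k : Fin d) :
    bump (zPlaqReflect i c₀ p) k = bump p k := rfl

/-- The `i`-coordinate of the base point of a reflected plaquette that touches direction `i`: `2c₀ − p.1 i − 1`. -/
theorem zPlaqReflect_fst_self_of_touches {i : Fin d} (c₀ : ℤ) {p : ZdPlaquette d} (h : ZTouches i p) :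
    (zPlaqReflect i c₀ p).1 i = c₀ + c₀ - p.1 i - 1 := by
  simp [zPlaqReflect, h, zReflect]

/-- The `i`-coordinate of the base point of a reflected plaquette not touching direction `i`: `2c₀ − p.1 i`. -/
theorem zPlaqReflect_fst_self_of_not {i : Fin d} (c₀ : ℤ) {p : ZdPlaquette d} (h : ¬ ZTouches i p) :
    (zPlaqReflect i c₀ p).1 i = c₀ + c₀ - p.1 i := by
  simp [zPlaqReflect, h, zReflect]

/-- The plaquette reflection does not move the base-point coordinates `k ≠ i`. -/
theorem zPlaqReflect_fst_ne (i : Fin d) (c₀ : ℤ) (p : ZdPlaquette d) {k : Fin d} (hk : k ≠ i) :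
    (zPlaqReflect i c₀ p).1 k = p.1 k := by
  unfold zPlaqReflect
  split_ifs <;> simp [zReflect, hk]

/-- `zReflect i c₀` is an involution on `ℤ^d`. -/
theorem zReflect_zReflect (i : Fin d) (c₀ : ℤ) (x : Fin d → ℤ) : zReflect i c₀ (zReflect i c₀ x) = x := by
  ext k
  by_cases hk : k = i
  · subst hk; simp [zReflect]
  · simp [zReflect, hk]

/-- `zReflect i c₀ (x − e_i) = zReflect i c₀ x + e_i`. -/
theorem zReflect_sub_single (i : Fin d) (c₀ : ℤ) (x : Fin d → ℤ) :
    zReflect i c₀ (x - Pi.single i 1) = zReflect i c₀ x + Pi.single i 1 := by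
  ext k
  by_cases hk : k = i
  · subst hk; simp [zReflect]; ring
  · simp [zReflect, hk]

/-- `zPlaqReflect i c₀` is an involution on `ℤ^d` plaquettes. -/
theorem zPlaqReflect_zPlaqReflect (i : Fin d) (c₀ : ℤ) (p : ZdPlaquette d) :
    zPlaqReflect i c₀ (zPlaqReflect i c₀ p) = p := by
  obtain ⟨x, jk⟩ := p
  unfold zPlaqReflect ZTouches
  by_cases h : jk.1.1 = i ∨ jk.1.2 = i
  · simp only [h, if_true, zReflect_sub_single, zReflect_zReflect, add_sub_cancel_right]
  · simp only [h, if_false, zReflect_zReflect]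

/-- The plaquettes of the closed lattice box `∏_k [lo_k, hi_k]` (all four corners inside). -/
def boxPlaqs (lo hi : Fin d → ℤ) : Finset (ZdPlaquette d) :=
  ((Fintype.piFinset fun k => Finset.Icc (lo k) (hi k)) ×ˢ Finset.univ).filter fun p => ∀ k, p.1 k + bump p k ≤ hi k

/-- Membership in `boxPlaqs lo hi`: the plaquette (base point plus its unit square) fits in the box `[lo, hi]`. -/
theorem mem_boxPlaqs {lo hi : Fin d → ℤ} {p : ZdPlaquette d} :
    p ∈ boxPlaqs lo hi ↔ ∀ k, lo k ≤ p.1 k ∧ p.1 k + bump p k ≤ hi k := by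
  unfold boxPlaqs
  rw [mem_filter, mem_product, Fintype.mem_piFinset]
  simp only [mem_Icc, mem_univ, and_true]
  constructor
  · rintro ⟨h1, h2⟩ k; exact ⟨(h1 k).1, h2 k⟩
  · intro h
    refine ⟨fun k => ⟨(h k).1, ?_⟩, fun k => (h k).2⟩
    have := (h k).2; have := bump_nonneg p k; omega

/-- Chatterjee's cube `cubePlaqs d n` (plaquettes with all corners in `[0,n)^d`) in coordinates. -/
theorem mem_cubePlaqs_iff (n : ℕ) (p : ZdPlaquette d) :
    p ∈ ChatterjeeFreeEnergy.cubePlaqs d n ↔ ∀ k, 0 ≤ p.1 k ∧ p.1 k + bump p k + 1 ≤ n := by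
  have hne : p.2.1.1 ≠ p.2.1.2 := ne_of_lt p.2.2
  unfold ChatterjeeFreeEnergy.cubePlaqs
  rw [mem_filter, FreeEnergy.mem_boxPlaqs, Plaq.mem_plaquettesIn]
  simp only [Plaq.ofZd, Literature.Probability.LatticeModels.mem_halfOpenBox, Pi.add_apply, Pi.single_apply,
    bump_eq]
  constructor
  · rintro ⟨h0, -, -, -, -, h3⟩ k
    have a0 := h0 k
    have a3 := h3 k
    refine ⟨a0.1, ?_⟩
    by_cases e1 : k = p.2.1.1 <;> by_cases e2 : k = p.2.1.2 <;>
      simp only [e1, e2, hne, hne.symm, if_true, if_false] at a3 ⊢ <;> omega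
  · intro h
    refine ⟨fun k => ⟨(h k).1, ?_⟩, fun k => ⟨(h k).1, ?_⟩, p.2.2, fun k => ?_, fun k => ?_, fun k => ?_⟩ <;>
    · have a := h k
      by_cases e1 : k = p.2.1.1 <;> by_cases e2 : k = p.2.1.2 <;>
        simp only [e1, e2, hne, hne.symm, if_true, if_false] at a ⊢ <;> omega

/-- Chatterjee's `cubePlaqs d n` is the box `boxPlaqs 0 (n − 1)`. -/
theorem cubePlaqs_eq_boxPlaqs (n : ℕ) :
    ChatterjeeFreeEnergy.cubePlaqs d n = boxPlaqs (fun _ => (0 : ℤ)) (fun _ => (n : ℤ) - 1) := by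
  ext p
  rw [mem_cubePlaqs_iff, mem_boxPlaqs]
  exact forall_congr' fun k => by constructor <;> rintro ⟨h1, h2⟩ <;> exact ⟨h1, by omega⟩

/-- Translating a box of plaquettes. -/
theorem boxPlaqs_image_shift (lo hi v : Fin d → ℤ) :
    (boxPlaqs lo hi).image (fun p : ZdPlaquette d => (p.1 + v, p.2)) = boxPlaqs (lo + v) (hi + v) := by
  ext q
  constructor
  · intro hq
    obtain ⟨p, hp, rfl⟩ := mem_image.1 hq
    rw [mem_boxPlaqs] at hp ⊢
    intro k
    have := hp k
    have hb : bump ((p.1 + v, p.2) : ZdPlaquette d) k = bump p k := rfl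
    simp only [Pi.add_apply, hb]
    omega
  · intro hq
    rw [mem_boxPlaqs] at hq
    refine mem_image.2 ⟨(q.1 - v, q.2), ?_, ?_⟩
    · rw [mem_boxPlaqs]
      intro k
      have := hq k
      have hb : bump ((q.1 - v, q.2) : ZdPlaquette d) k = bump q k := rfl
      simp only [Pi.sub_apply, Pi.add_apply, hb] at this ⊢
      omega
    · simp

/-- **Reflecting a box in its bottom face doubles it**:
`B ∪ θ(B ∖ face) = ` the box with `lo_i` replaced by `2 lo_i - hi_i`. -/
theorem zDouble_boxPlaqs (lo hi : Fin d → ℤ) (i : Fin d) (hi_ : lo i ≤ hi i) :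
    zDouble i (lo i) (boxPlaqs lo hi) = boxPlaqs (Function.update lo i (2 * lo i - hi i)) hi := by
  ext q
  rw [zDouble, mem_union, mem_image]
  constructor
  · rintro (hq | ⟨p, hp, rfl⟩)
    · rw [mem_boxPlaqs] at hq ⊢
      intro k
      have := hq k
      by_cases hk : k = i
      · subst hk; rw [Function.update_self]; omega
      · rw [Function.update_of_ne hk]; exact this
    · rw [mem_filter, mem_boxPlaqs] at hp
      obtain ⟨hp, hnf⟩ := hp
      rw [mem_boxPlaqs]
      intro k
      by_cases hk : k = i
      · subst hk
        rw [Function.update_self, bump_zPlaqReflect]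
        have hpk := hp k
        by_cases ht : ZTouches k p
        · rw [zPlaqReflect_fst_self_of_touches (lo k) ht]
          rw [bump_of_touches ht] at hpk ⊢
          omega
        · rw [zPlaqReflect_fst_self_of_not (lo k) ht]
          rw [bump_of_not_touches ht] at hpk ⊢
          have hne : p.1 k ≠ lo k := fun h => hnf ⟨ht, h⟩
          omega
      · rw [Function.update_of_ne hk, bump_zPlaqReflect, zPlaqReflect_fst_ne i (lo i) p hk]
        exact hp k
  · intro hq
    rw [mem_boxPlaqs] at hq
    by_cases hqi : lo i ≤ q.1 i
    · left
      rw [mem_boxPlaqs]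
      intro k
      have := hq k
      by_cases hk : k = i
      · subst hk; exact ⟨hqi, this.2⟩
      · rw [Function.update_of_ne hk] at this; exact this
    · right
      push Not at hqi
      have hqi' := hq i
      rw [Function.update_self] at hqi'
      refine ⟨zPlaqReflect i (lo i) q, ?_, zPlaqReflect_zPlaqReflect i (lo i) q⟩
      rw [mem_filter, mem_boxPlaqs]
      refine ⟨fun k => ?_, ?_⟩
      · by_cases hk : k = i
        · subst hk
          rw [bump_zPlaqReflect]
          by_cases ht : ZTouches k q
          · rw [zPlaqReflect_fst_self_of_touches (lo k) ht]
            rw [bump_of_touches ht] at hqi' ⊢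
            omega
          · rw [zPlaqReflect_fst_self_of_not (lo k) ht]
            rw [bump_of_not_touches ht] at hqi' ⊢
            omega
        · have := hq k
          rw [Function.update_of_ne hk] at this
          rw [bump_zPlaqReflect, zPlaqReflect_fst_ne i (lo i) q hk]
          exact this
      · have hT : ZTouches i (zPlaqReflect i (lo i) q) ↔ ZTouches i q := Iff.rfl
        unfold ZIsFace
        rw [hT]
        rintro ⟨hnt, hc0⟩
        rw [zPlaqReflect_fst_self_of_not (lo i) hnt] at hc0
        omega

end Boxes

end

end Summit.QuantumFields.YangMills.Cruxes.IR.RPDoubling
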